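import Mathlib
import Summits.Ventures.PercRepro2.Defs
import Summits.Ventures.PercRepro2.Independence
import Summits.Ventures.PercRepro2.Harris
import Summits.Ventures.PercRepro2.CoinDefs
import Summits.Ventures.PercRepro2.CoinArcsOff
import Summits.Ventures.PercRepro2.CoinPendantDefs
import Summits.Ventures.PercRepro2.CoinPendant
import Summits.Ventures.PercRepro2.CoinInduced
import Summits.Ventures.PercRepro2.CoinVdBK
import Summits.Ventures.PercRepro2.CoinBHK
import Summits.Ventures.PercRepro2.CoinReverse
import Summits.Ventures.PercRepro2.CoinLemmaA
import Summits.Ventures.PercRepro2.CoinDarcMixed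
import Summits.Ventures.PercRepro2.CoinTwoPendantDefs
import Summits.Ventures.PercRepro2.CoinTwoPendantMass
import Summits.Ventures.PercRepro2.CoinTraceLevels
import Summits.Ventures.PercRepro2.CoinTraceTower
import Summits.Ventures.PercRepro2.CoinTraceReduce
import Summits.Ventures.PercRepro2.CoinTraceFn
import Summits.Ventures.PercRepro2.CoinTraceBlock
import Summits.Ventures.PercRepro2.CoinTraceShift
import Summits.Ventures.PercRepro2.CoinTwoStar

/-!
# Row 2′DARC at every pendant head with at most TWO pivotal traces (blind cell PercRepro2,
night-2 g3; proofs/NIGHT2-DARC.md §17.7)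

A closed-out pendant set `P ∋ w` (single target `t`) whose PIVOTAL traces — the traces
`Z = K⁻ ∩ P ∋ w` of positive probability — are at most `Z₁` and `P` itself, with `w ∈ Z₁ ⊆ P`.
Then `S′ ≥ 0` by the three sign blocks (a), (b), (c) of NIGHT2-DARC.md §15.7 alone (Abel over the
chain `{P} ⊂ {Z₁, P}` of up-sets; no cylinder input) — `pivotalPair_functional_nonneg` — and
`darc_of_pivotal_pair` follows from the general reduction `darc_of_trace_functional`.  Instances:
every two-vertex head (`Z₁ = {w}`), the DIAMOND `w → v₁ → v₂ → t, w → v₂` (`Z₁ = {w, v₂}`), the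
SIDE-BRANCH `w → v₁ → t, v₁ → v₂ → t` (`Z₁ = {w, v₁}`), and every head in which the head `w`
forces a fixed set of pendant vertices into `K⁻` and the remaining ones are forced by the top.
-/

namespace Summit.Ventures.PercRepro2.Coin

section Abstract

open Classical

variable {V : Type*} [DecidableEq V] {R : Type*} [Field R] [LinearOrder R] [IsStrictOrderedRing R]

omit [LinearOrder R] [IsStrictOrderedRing R] in
/-- The pointwise Abel decomposition of the pivotal weight when the pivotal traces are `Z₁ ⊆ P`. -/
lemma pivotalPair_rho_decomp (P : Finset V) {w : V} {Z₁ : Finset V} (hwZ₁ : w ∈ Z₁)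
    (μ ρ : Finset V → R)
    (hμ0 : ∀ Z ∈ P.powerset, w ∈ Z → Z ≠ Z₁ → Z ≠ P → μ Z = 0)
    (hρ1 : ∀ Z ∈ P.powerset, w ∉ Z → ρ Z = 1) {Z : Finset V} (hZ : Z ∈ P.powerset) :
    μ Z * ρ Z = μ Z * ((1 - ρ P) * (if Disjoint Z {w} then (1 : R) else 0)
      + (ρ P - ρ Z₁) * (if Disjoint Z {w} ∨ Z = P then (1 : R) else 0) + ρ Z₁) := by
  by_cases hw : w ∈ Z
  · have hd : ¬ Disjoint Z {w} := fun h => Finset.disjoint_singleton_right.mp h hw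
    by_cases hZP : Z = P
    · subst hZP
      simp only [hd, if_true, if_false, or_true]
      ring
    · by_cases hZ₁ : Z = Z₁
      · subst hZ₁
        simp only [hd, hZP, or_self, if_false]
        ring
      · rw [hμ0 Z hZ hw hZ₁ hZP]
        ring
  · have hd : Disjoint Z {w} := Finset.disjoint_singleton_right.mpr hw
    rw [hρ1 Z hZ hw]
    simp only [hd, true_or, if_true]
    ring

/-- **The abstract pendant lemma for at most two pivotal traces** `Z₁ ⊆ P`:
`S′ = Σ_Z μ_Z ρ_Z (x̂_Z Λ − MX)(ŷ_Z Λ − MY) ≥ 0`. -/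
theorem pivotalPair_functional_nonneg (P : Finset V) {w : V} (hwP : w ∈ P) {Z₁ : Finset V}
    (hwZ₁ : w ∈ Z₁) (μ x y xh yh ρ : Finset V → R)
    (hμ : ∀ Z ∈ P.powerset, 0 ≤ μ Z)
    (hμ0 : ∀ Z ∈ P.powerset, w ∈ Z → Z ≠ Z₁ → Z ≠ P → μ Z = 0)
    (hx1 : ∀ Z : Finset V, Z ⊆ P → x Z ≤ 1) (hy1 : ∀ Z : Finset V, Z ⊆ P → y Z ≤ 1)
    (hxh1 : ∀ Z : Finset V, Z ⊆ P → xh Z ≤ 1) (hyh1 : ∀ Z : Finset V, Z ⊆ P → yh Z ≤ 1)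
    (hxanti : ∀ Z Z' : Finset V, Z ⊆ Z' → Z' ⊆ P → x Z' ≤ x Z)
    (hyanti : ∀ Z Z' : Finset V, Z ⊆ Z' → Z' ⊆ P → y Z' ≤ y Z)
    (hxhanti : ∀ Z Z' : Finset V, Z ⊆ Z' → Z' ⊆ P → xh Z' ≤ xh Z)
    (hyhanti : ∀ Z Z' : Finset V, Z ⊆ Z' → Z' ⊆ P → yh Z' ≤ yh Z)
    (hxh_le : ∀ Z : Finset V, Z ⊆ P → xh Z ≤ x Z) (hyh_le : ∀ Z : Finset V, Z ⊆ P → yh Z ≤ y Z)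
    (hxh_eq : ∀ Z : Finset V, Z ⊆ P → w ∉ Z → xh Z = x Z)
    (hyh_eq : ∀ Z : Finset V, Z ⊆ P → w ∉ Z → yh Z = y Z)
    (hρ1 : ∀ Z ∈ P.powerset, w ∉ Z → ρ Z = 1) (hρ0 : 0 ≤ ρ Z₁) (hρle : ρ P ≤ 1)
    (hρ₁ : ρ Z₁ ≤ ρ P) (hPA : TracePA P μ) :
    0 ≤ ∑ Z ∈ P.powerset, μ Z * ρ Z *
      (xh Z * (∑ Z' ∈ P.powerset, μ Z') - ∑ Z' ∈ P.powerset, x Z' * μ Z') *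
      (yh Z * (∑ Z' ∈ P.powerset, μ Z') - ∑ Z' ∈ P.powerset, y Z' * μ Z') := by
  obtain ⟨Λ, hΛ⟩ : ∃ L : R, L = ∑ Z ∈ P.powerset, μ Z := ⟨_, rfl⟩
  obtain ⟨MX, hMX⟩ : ∃ M : R, M = ∑ Z ∈ P.powerset, x Z * μ Z := ⟨_, rfl⟩
  obtain ⟨MY, hMY⟩ : ∃ M : R, M = ∑ Z ∈ P.powerset, y Z * μ Z := ⟨_, rfl⟩
  rw [← hΛ, ← hMX, ← hMY]
  have hΛn : 0 ≤ Λ := by rw [hΛ]; exact Finset.sum_nonneg hμ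
  have monX : ∀ Z Z' : Finset V, Z ⊆ Z' → Z' ⊆ P → (fun Z => 1 - xh Z) Z ≤ (fun Z => 1 - xh Z) Z' :=
    fun Z Z' h h' => by show 1 - xh Z ≤ 1 - xh Z'; linarith [hxhanti Z Z' h h']
  have monY : ∀ Z Z' : Finset V, Z ⊆ Z' → Z' ⊆ P → (fun Z => 1 - yh Z) Z ≤ (fun Z => 1 - yh Z) Z' :=
    fun Z Z' h h' => by show 1 - yh Z ≤ 1 - yh Z'; linarith [hyhanti Z Z' h h']
  have nnX : ∀ Z : Finset V, Z ⊆ P → 0 ≤ (fun Z => 1 - xh Z) Z :=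
    fun Z h => by show 0 ≤ 1 - xh Z; linarith [hxh1 Z h]
  have nnY : ∀ Z : Finset V, Z ⊆ P → 0 ≤ (fun Z => 1 - yh Z) Z :=
    fun Z h => by show 0 ≤ 1 - yh Z; linarith [hyh1 Z h]
  -- the top trace
  have hxtop : xh P * Λ - MX ≤ 0 := by
    have h1 : x P * Λ ≤ MX := by
      rw [hΛ, hMX, Finset.mul_sum]
      exact Finset.sum_le_sum fun Z hZ => mul_le_mul_of_nonneg_right
        (hxanti Z P (Finset.mem_powerset.mp hZ) (subset_refl _)) (hμ Z hZ)
    have h2 : xh P * Λ ≤ x P * Λ := mul_le_mul_of_nonneg_right (hxh_le P (subset_refl _)) hΛn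
    linarith
  have hytop : yh P * Λ - MY ≤ 0 := by
    have h1 : y P * Λ ≤ MY := by
      rw [hΛ, hMY, Finset.mul_sum]
      exact Finset.sum_le_sum fun Z hZ => mul_le_mul_of_nonneg_right
        (hyanti Z P (Finset.mem_powerset.mp hZ) (subset_refl _)) (hμ Z hZ)
    have h2 : yh P * Λ ≤ y P * Λ := mul_le_mul_of_nonneg_right (hyh_le P (subset_refl _)) hΛn
    linarith
  -- BLOCK A: `𝒩_w`
  have hA : 0 ≤ ∑ Z ∈ P.powerset.filter (fun Z => Disjoint Z {w}),
      μ Z * (xh Z * Λ - MX) * (yh Z * Λ - MY) := by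
    refine block_nonneg _ μ xh yh Λ MX MY (fun Z hZ => hμ Z (Finset.mem_filter.mp hZ).1) ?_
      (Or.inl ⟨?_, ?_⟩)
    · exact hPA {w} (Finset.singleton_subset_iff.mpr hwP) _ _ monX monY nnX nnY
    · have h := shift_avoid_of_tracePA P μ x hPA hx1 hxanti {w}
      rw [← hΛ, ← hMX] at h
      have e : ∑ Z ∈ P.powerset.filter (fun Z => Disjoint Z {w}), xh Z * μ Z =
          ∑ Z ∈ P.powerset.filter (fun Z => Disjoint Z {w}), x Z * μ Z :=
        Finset.sum_congr rfl fun Z hZ => by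
          rw [hxh_eq Z (Finset.mem_powerset.mp (Finset.mem_filter.mp hZ).1)
            (Finset.disjoint_singleton_right.mp (Finset.mem_filter.mp hZ).2)]
      rw [e]; exact h
    · have h := shift_avoid_of_tracePA P μ y hPA hy1 hyanti {w}
      rw [← hΛ, ← hMY] at h
      have e : ∑ Z ∈ P.powerset.filter (fun Z => Disjoint Z {w}), yh Z * μ Z =
          ∑ Z ∈ P.powerset.filter (fun Z => Disjoint Z {w}), y Z * μ Z :=
        Finset.sum_congr rfl fun Z hZ => by
          rw [hyh_eq Z (Finset.mem_powerset.mp (Finset.mem_filter.mp hZ).1)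
            (Finset.disjoint_singleton_right.mp (Finset.mem_filter.mp hZ).2)]
      rw [e]; exact h
  -- BLOCK B: `𝒩_w ∪ {P}`
  have hB : 0 ≤ ∑ Z ∈ P.powerset.filter (fun Z => Disjoint Z {w} ∨ Z = P),
      μ Z * (xh Z * Λ - MX) * (yh Z * Λ - MY) := by
    rw [← Finset.sum_filter_add_sum_filter_not _ (fun Z => Disjoint Z {w})]
    have e1 : (P.powerset.filter (fun Z => Disjoint Z {w} ∨ Z = P)).filter
        (fun Z => Disjoint Z {w}) = P.powerset.filter (fun Z => Disjoint Z {w}) := by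
      rw [Finset.filter_filter]
      exact Finset.filter_congr fun Z _ => ⟨fun h => h.2, fun h => ⟨Or.inl h, h⟩⟩
    rw [e1]
    refine add_nonneg hA (Finset.sum_nonneg fun Z hZ => ?_)
    rw [Finset.mem_filter, Finset.mem_filter, Finset.mem_powerset] at hZ
    obtain ⟨⟨_, hBZ⟩, hnA⟩ := hZ
    rcases hBZ with hA' | hZe
    · exact absurd hA' hnA
    · rw [hZe]
      exact mul_nonneg_of_nonpos_of_nonpos
        (mul_nonpos_of_nonneg_of_nonpos (hμ P (Finset.mem_powerset_self _)) hxtop) hytop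
  -- BLOCK D: the whole family with the pivotal data
  have hD : 0 ≤ ∑ Z ∈ P.powerset, μ Z * (xh Z * Λ - MX) * (yh Z * Λ - MY) := by
    refine block_nonneg _ μ xh yh Λ MX MY hμ ?_ (Or.inr ⟨?_, ?_⟩)
    · have h := hPA ∅ (Finset.empty_subset _) _ _ monX monY nnX nnY
      simpa only [filter_disjoint_empty] using h
    · have h2 : ∑ Z ∈ P.powerset, xh Z * μ Z ≤ MX := by
        rw [hMX]
        exact Finset.sum_le_sum fun Z hZ => mul_le_mul_of_nonneg_right
          (hxh_le Z (Finset.mem_powerset.mp hZ)) (hμ Z hZ)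
      rw [← hΛ]
      exact mul_le_mul_of_nonneg_right h2 hΛn
    · have h2 : ∑ Z ∈ P.powerset, yh Z * μ Z ≤ MY := by
        rw [hMY]
        exact Finset.sum_le_sum fun Z hZ => mul_le_mul_of_nonneg_right
          (hyh_le Z (Finset.mem_powerset.mp hZ)) (hμ Z hZ)
      rw [← hΛ]
      exact mul_le_mul_of_nonneg_right h2 hΛn
  -- ABEL
  have hdec : ∑ Z ∈ P.powerset, μ Z * ρ Z * (xh Z * Λ - MX) * (yh Z * Λ - MY) =
      (1 - ρ P) * ∑ Z ∈ P.powerset.filter (fun Z => Disjoint Z {w}),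
          μ Z * (xh Z * Λ - MX) * (yh Z * Λ - MY)
      + (ρ P - ρ Z₁) * ∑ Z ∈ P.powerset.filter (fun Z => Disjoint Z {w} ∨ Z = P),
          μ Z * (xh Z * Λ - MX) * (yh Z * Λ - MY)
      + ρ Z₁ * ∑ Z ∈ P.powerset, μ Z * (xh Z * Λ - MX) * (yh Z * Λ - MY) := by
    have e : ∀ Z ∈ P.powerset, μ Z * ρ Z * (xh Z * Λ - MX) * (yh Z * Λ - MY) =
        (1 - ρ P) * ((if Disjoint Z {w} then (1 : R) else 0) *
            (μ Z * (xh Z * Λ - MX) * (yh Z * Λ - MY)))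
        + (ρ P - ρ Z₁) * ((if Disjoint Z {w} ∨ Z = P then (1 : R) else 0) *
            (μ Z * (xh Z * Λ - MX) * (yh Z * Λ - MY)))
        + ρ Z₁ * (μ Z * (xh Z * Λ - MX) * (yh Z * Λ - MY)) := by
      intro Z hZ
      have hd := pivotalPair_rho_decomp P hwZ₁ μ ρ hμ0 hρ1 hZ
      rw [show μ Z * ρ Z * (xh Z * Λ - MX) * (yh Z * Λ - MY) =
        (μ Z * ρ Z) * ((xh Z * Λ - MX) * (yh Z * Λ - MY)) by ring, hd]
      ring
    rw [Finset.sum_congr rfl e, Finset.sum_add_distrib, Finset.sum_add_distrib,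
      ← Finset.mul_sum, ← Finset.mul_sum, ← Finset.mul_sum, sum_ite_mul_eq_sum_filter,
      sum_ite_mul_eq_sum_filter]
  rw [hdec]
  have h1 : 0 ≤ 1 - ρ P := by linarith
  have h2 : 0 ≤ ρ P - ρ Z₁ := by linarith
  exact add_nonneg (add_nonneg (mul_nonneg h1 hA) (mul_nonneg h2 hB)) (mul_nonneg hρ0 hD)

end Abstract

section Concrete

open Classical

variable {V : Type*} {E : Type*} [Fintype V] [DecidableEq V] [Fintype E] [DecidableEq E]
  {R : Type*} [Field R] [LinearOrder R] [IsStrictOrderedRing R]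

/-- **THEOREM (row 2′DARC at every pendant head with at most two pivotal traces).** `P ∋ w`
closed out into the single target `t` with mixed pendant coins; every trace `Z ∋ w` other than
`Z₁` and `P` has an empty level; `a, b, u ∉ P ∪ {t}`; the reduced events non-degenerate. -/
theorem darc_of_pivotal_pair (p : E → R) (hp : IsProbVec p) {arcs : E → Finset (V × V)}
    (hS : SameEnds arcs) {P : Finset V} {t : V} (hclosed : ClosedOut arcs P {t})
    (hT : TailCoinsIn arcs P {t}) (s a b u w : V) (hwP : w ∈ P) {Z₁ : Finset V} (hZ₁P : Z₁ ⊆ P)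
    (hwZ₁ : w ∈ Z₁)
    (hlev : ∀ Z ∈ P.powerset, w ∈ Z → Z ≠ Z₁ → Z ≠ P → traceLevel arcs {t} P Z = ∅)
    (ha : a ∉ P ∪ {t}) (hb : b ∉ P ∪ {t}) (hu : u ∉ P ∪ {t})
    (hP : ∀ Z ∈ P.powerset, 0 < prob p (avoidEvent (arcsOff arcs (P ∪ {t})) s (Z ∪ {t})))
    (hQ : ∀ Z ∈ P.powerset,
      0 < prob p (avoidEvent (arcsOff arcs (P ∪ {t})) s (gateTarget u w Z {t}))) :
    DARC p arcs s {t} a b u w := by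
  have hS₀ : SameEnds (arcsOff arcs (P ∪ {t})) := sameEnds_arcsOff hS _
  refine darc_of_trace_functional p hp hS hclosed hT s a b u w hwP ha hb hu hQ ?_
  set D₀ := arcsOff arcs (P ∪ {t}) with hD₀
  set X₀ : Config E → R := marker D₀ s a with hX₀
  set Y₀ : Config E → R := marker D₀ s b with hY₀
  set ℓ : Finset V → R := fun Z => prob p (traceLevel arcs {t} P Z) with hℓ
  set Pz : Finset V → R := fun Z => prob p (avoidEvent D₀ s (Z ∪ {t})) with hPz
  set Qz : Finset V → R := fun Z => prob p (avoidEvent D₀ s (gateTarget u w Z {t})) with hQz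
  set Az : Finset V → R := fun Z => massE p X₀ (avoidEvent D₀ s (Z ∪ {t})) with hAz
  set Bz : Finset V → R := fun Z => massE p Y₀ (avoidEvent D₀ s (Z ∪ {t})) with hBz
  set Ahz : Finset V → R := fun Z => massE p X₀ (avoidEvent D₀ s (gateTarget u w Z {t})) with hAhz
  set Bhz : Finset V → R := fun Z => massE p Y₀ (avoidEvent D₀ s (gateTarget u w Z {t})) with hBhz
  have hPpos : ∀ Z : Finset V, Z ⊆ P → 0 < Pz Z := fun Z hZ => hP Z (Finset.mem_powerset.mpr hZ)
  have hQpos : ∀ Z : Finset V, Z ⊆ P → 0 < Qz Z := fun Z hZ => hQ Z (Finset.mem_powerset.mpr hZ)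
  have hMX : ∑ Z ∈ P.powerset, Az Z / Pz Z * (ℓ Z * Pz Z) = ∑ Z ∈ P.powerset, ℓ Z * Az Z := by
    refine Finset.sum_congr rfl fun Z hZ => ?_
    have := (hPpos Z (Finset.mem_powerset.mp hZ)).ne'
    field_simp
  have hMY : ∑ Z ∈ P.powerset, Bz Z / Pz Z * (ℓ Z * Pz Z) = ∑ Z ∈ P.powerset, ℓ Z * Bz Z := by
    refine Finset.sum_congr rfl fun Z hZ => ?_
    have := (hPpos Z (Finset.mem_powerset.mp hZ)).ne'
    field_simp
  have key : ∑ Z ∈ P.powerset, ℓ Z * Pz Z * (Qz Z / Pz Z) *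
        (Ahz Z / Qz Z * (∑ Z' ∈ P.powerset, ℓ Z' * Pz Z')
          - ∑ Z' ∈ P.powerset, Az Z' / Pz Z' * (ℓ Z' * Pz Z')) *
        (Bhz Z / Qz Z * (∑ Z' ∈ P.powerset, ℓ Z' * Pz Z')
          - ∑ Z' ∈ P.powerset, Bz Z' / Pz Z' * (ℓ Z' * Pz Z')) =
      ∑ Z ∈ P.powerset, ℓ Z * Qz Z *
        (Ahz Z / Qz Z * (∑ Z' ∈ P.powerset, ℓ Z' * Pz Z') - ∑ Z' ∈ P.powerset, ℓ Z' * Az Z') *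
        (Bhz Z / Qz Z * (∑ Z' ∈ P.powerset, ℓ Z' * Pz Z') - ∑ Z' ∈ P.powerset, ℓ Z' * Bz Z') := by
    rw [hMX, hMY]
    refine Finset.sum_congr rfl fun Z hZ => ?_
    have := (hPpos Z (Finset.mem_powerset.mp hZ)).ne'
    field_simp
  rw [← key]
  have hμ : ∀ Z ∈ P.powerset, 0 ≤ ℓ Z * Pz Z :=
    fun Z _ => mul_nonneg (prob_nonneg hp _) (prob_nonneg hp _)
  have hμ0 : ∀ Z ∈ P.powerset, w ∈ Z → Z ≠ Z₁ → Z ≠ P → ℓ Z * Pz Z = 0 := by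
    intro Z hZ hw h1 h2
    have : ℓ Z = 0 := by
      show prob p (traceLevel arcs {t} P Z) = 0
      rw [hlev Z hZ hw h1 h2, prob_empty]
    rw [this, zero_mul]
  have hx1 : ∀ Z : Finset V, Z ⊆ P → Az Z / Pz Z ≤ 1 := fun Z hZ =>
    (div_le_one₀ (hPpos Z hZ)).mpr (massE_marker_le_prob p hp D₀ s a _)
  have hy1 : ∀ Z : Finset V, Z ⊆ P → Bz Z / Pz Z ≤ 1 := fun Z hZ =>
    (div_le_one₀ (hPpos Z hZ)).mpr (massE_marker_le_prob p hp D₀ s b _)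
  have hxh1 : ∀ Z : Finset V, Z ⊆ P → Ahz Z / Qz Z ≤ 1 := fun Z hZ =>
    (div_le_one₀ (hQpos Z hZ)).mpr (massE_marker_le_prob p hp D₀ s a _)
  have hyh1 : ∀ Z : Finset V, Z ⊆ P → Bhz Z / Qz Z ≤ 1 := fun Z hZ =>
    (div_le_one₀ (hQpos Z hZ)).mpr (massE_marker_le_prob p hp D₀ s b _)
  have hxanti : ∀ Z Z' : Finset V, Z ⊆ Z' → Z' ⊆ P → Az Z' / Pz Z' ≤ Az Z / Pz Z :=
    fun Z Z' hZZ' hZ'P => (div_le_div_iff₀ (hPpos Z' hZ'P) (hPpos Z (hZZ'.trans hZ'P))).mpr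
      (shift_avoid_more_C p hp hS₀ s a (Finset.union_subset_union_left hZZ'))
  have hyanti : ∀ Z Z' : Finset V, Z ⊆ Z' → Z' ⊆ P → Bz Z' / Pz Z' ≤ Bz Z / Pz Z :=
    fun Z Z' hZZ' hZ'P => (div_le_div_iff₀ (hPpos Z' hZ'P) (hPpos Z (hZZ'.trans hZ'P))).mpr
      (shift_avoid_more_C p hp hS₀ s b (Finset.union_subset_union_left hZZ'))
  have hxhanti : ∀ Z Z' : Finset V, Z ⊆ Z' → Z' ⊆ P → Ahz Z' / Qz Z' ≤ Ahz Z / Qz Z :=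
    fun Z Z' hZZ' hZ'P => (div_le_div_iff₀ (hQpos Z' hZ'P) (hQpos Z (hZZ'.trans hZ'P))).mpr
      (shift_avoid_more_C p hp hS₀ s a (gateTarget_mono u w hZZ' {t}))
  have hyhanti : ∀ Z Z' : Finset V, Z ⊆ Z' → Z' ⊆ P → Bhz Z' / Qz Z' ≤ Bhz Z / Qz Z :=
    fun Z Z' hZZ' hZ'P => (div_le_div_iff₀ (hQpos Z' hZ'P) (hQpos Z (hZZ'.trans hZ'P))).mpr
      (shift_avoid_more_C p hp hS₀ s b (gateTarget_mono u w hZZ' {t}))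
  have hxh_le : ∀ Z : Finset V, Z ⊆ P → Ahz Z / Qz Z ≤ Az Z / Pz Z := fun Z hZ =>
    (div_le_div_iff₀ (hQpos Z hZ) (hPpos Z hZ)).mpr
      (shift_avoid_more_C p hp hS₀ s a (subset_gateTarget u w Z {t}))
  have hyh_le : ∀ Z : Finset V, Z ⊆ P → Bhz Z / Qz Z ≤ Bz Z / Pz Z := fun Z hZ =>
    (div_le_div_iff₀ (hQpos Z hZ) (hPpos Z hZ)).mpr
      (shift_avoid_more_C p hp hS₀ s b (subset_gateTarget u w Z {t}))
  have hxh_eq : ∀ Z : Finset V, Z ⊆ P → w ∉ Z → Ahz Z / Qz Z = Az Z / Pz Z := by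
    intro Z _ hwZ
    show massE p X₀ (avoidEvent D₀ s (gateTarget u w Z {t})) /
        prob p (avoidEvent D₀ s (gateTarget u w Z {t})) = _
    rw [gateTarget_of_notMem hwZ]
  have hyh_eq : ∀ Z : Finset V, Z ⊆ P → w ∉ Z → Bhz Z / Qz Z = Bz Z / Pz Z := by
    intro Z _ hwZ
    show massE p Y₀ (avoidEvent D₀ s (gateTarget u w Z {t})) /
        prob p (avoidEvent D₀ s (gateTarget u w Z {t})) = _
    rw [gateTarget_of_notMem hwZ]
  have hρ1 : ∀ Z ∈ P.powerset, w ∉ Z → Qz Z / Pz Z = 1 := by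
    intro Z hZ hwZ
    show prob p (avoidEvent D₀ s (gateTarget u w Z {t})) / prob p (avoidEvent D₀ s (Z ∪ {t})) = 1
    rw [gateTarget_of_notMem hwZ]
    exact div_self (hP Z hZ).ne'
  have hρ0 : 0 ≤ Qz Z₁ / Pz Z₁ := div_nonneg (prob_nonneg hp _) (prob_nonneg hp _)
  have hρle : Qz P / Pz P ≤ 1 :=
    (div_le_one₀ (hPpos P (subset_refl _))).mpr
      (prob_mono hp fun ω hω t' ht' => hω t' (subset_gateTarget u w P {t} ht'))
  have hρ₁ : Qz Z₁ / Pz Z₁ ≤ Qz P / Pz P :=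
    (div_le_div_iff₀ (hPpos _ hZ₁P) (hPpos P (subset_refl _))).mpr
      (rho_mono_of_subset p hp hS s u w hu hZ₁P (subset_refl _) hwZ₁)
  have hPA : TracePA P (fun Z => ℓ Z * Pz Z) := by
    intro U hU f₁ f₂ h₁ h₂ h₁0 h₂0
    have h := trace_pa p hp hS hclosed hT hU s (monotone_traceFn P h₁) (monotone_traceFn P h₂)
      (traceFn_nonneg P h₁0) (traceFn_nonneg P h₂0)
    have e₁ : ∑ Z ∈ P.powerset.filter (fun Z => Disjoint Z U), traceFn P f₁ ↑Z * (ℓ Z * Pz Z) =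
        ∑ Z ∈ P.powerset.filter (fun Z => Disjoint Z U), f₁ Z * (ℓ Z * Pz Z) :=
      Finset.sum_congr rfl fun Z hZ => by
        rw [traceFn_coe P f₁ (Finset.mem_powerset.mp (Finset.mem_filter.mp hZ).1)]
    have e₂ : ∑ Z ∈ P.powerset.filter (fun Z => Disjoint Z U), traceFn P f₂ ↑Z * (ℓ Z * Pz Z) =
        ∑ Z ∈ P.powerset.filter (fun Z => Disjoint Z U), f₂ Z * (ℓ Z * Pz Z) :=
      Finset.sum_congr rfl fun Z hZ => by
        rw [traceFn_coe P f₂ (Finset.mem_powerset.mp (Finset.mem_filter.mp hZ).1)]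
    have e₁₂ : ∑ Z ∈ P.powerset.filter (fun Z => Disjoint Z U),
        traceFn P f₁ ↑Z * traceFn P f₂ ↑Z * (ℓ Z * Pz Z) =
        ∑ Z ∈ P.powerset.filter (fun Z => Disjoint Z U), f₁ Z * f₂ Z * (ℓ Z * Pz Z) :=
      Finset.sum_congr rfl fun Z hZ => by
        rw [traceFn_coe P f₁ (Finset.mem_powerset.mp (Finset.mem_filter.mp hZ).1),
          traceFn_coe P f₂ (Finset.mem_powerset.mp (Finset.mem_filter.mp hZ).1)]
    rw [e₁, e₂, e₁₂] at h
    exact h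
  exact pivotalPair_functional_nonneg P hwP hwZ₁ (fun Z => ℓ Z * Pz Z) (fun Z => Az Z / Pz Z)
    (fun Z => Bz Z / Pz Z) (fun Z => Ahz Z / Qz Z) (fun Z => Bhz Z / Qz Z) (fun Z => Qz Z / Pz Z)
    hμ hμ0 hx1 hy1 hxh1 hyh1 hxanti hyanti hxhanti hyhanti hxh_le hyh_le hxh_eq hyh_eq hρ1 hρ0
    hρle hρ₁ hPA

end Concrete

end Summit.Ventures.PercRepro2.Coin
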